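import Summits.HodgeConjecture.HodgeConjecture.Theorems.F0P3JacquetEmbeddingDichotomy   -- ★ D2′ `isSupercuspidal_or_exists_injective_intertwiningMap_cmPrincipalSeries_of_irrClass`
import Literature.NumberTheory.Automorphic.CMPrincipalSeriesJacquetEvalOne              -- ★ `continuous_cmTorusCharPair_apply`
import Literature.NumberTheory.Automorphic.IrreducibleClassesConstituents               -- ★ `IrrClass.isConstituentOf_mk_self`, `IrrClass.IsConstituentOf.of_injective`
import HarnessLib

/-!
# Crux `H413` — K2-LIT E3 «EllipticInputs», row 11 (U12-c `sig_K2E3CharLocIntNearSemisimple`), LEAF (11-3ns-cls) «CUSPIDAL OR PRINCIPAL at `N = 3`,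
# non-split `v`»: every irreducible smooth class of `U(Φ₃)(L⁺_v)` is supercuspidal or a constituent of a principal series `i_G(χ)`, `χ` continuous

Cell `hodgecm-mathlib`, Track B «K2-LIT», crux item `stmt-HodgeConjecture-24833` (h413), line `K2_E3_EllipticInputs`, socket U12-c :174 (row 11), leaf
(11-3ns-cls) of K2E3-p11 (g3)'s by-class re-tie cand v2 (`sig_K2E3IrrClassCuspidalOrPrincipalThree`, 8012ddf7 :67); deal (D49) of K2E3-plan (g2); seat K2E3-p10 (g4).
THEOREMS ONLY; count-neutral helper (`--supports stmt-HodgeConjecture-24833 --as helper`).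

The mathematics is Jacquet's subrepresentation theorem for the rank-one group `G = U(Φ₃)(L⁺_v)` at a non-split place: `r_B(π) = 0 ⇒ π` supercuspidal (★ N6
`u3_isSupercuspidal_iff_jacquet_eq_zero_holds`), `r_B(π) ≠ 0 ⇒ π ↪ i_G(χ)` for a quotient character `χ = (χ₁, χ₂)` of `r_B(π)` with continuous components — both already
assembled as ★ `F0P3JacquetEmbeddingDichotomy.isSupercuspidal_or_exists_injective_intertwiningMap_cmPrincipalSeries_of_irrClass` (D2′).  This file only re-spells
D2′ in the leaf's currency: ONE torus character `χ = cmTorusCharPair L v χ₁ χ₂` with continuous value (★ `continuous_cmTorusCharPair_apply`) and `IsConstituentOf`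
from the injective intertwiner (★ `IrrClass.isConstituentOf_mk_self`, ★ `IrrClass.IsConstituentOf.of_injective`).

* **`irrClass_isSupercuspidal_or_isConstituentOf_cmPrincipalSeries_three`** — the leaf (11-3ns-cls) VERBATIM:
  `∀ L v, (∀ w, c̄ • w = w) → ∀ c : IrrClass (Gqs L v), c.IsSupercuspidal ∨ ∃ χ : T(L⁺_v) →* ℂˣ, Continuous χ ∧ c.IsConstituentOf (cmPrincipalSeries L 3 v χ)`.

HONEST LABEL: pays one M leaf of row 11's relative re-tie (the other leaves (11-N≠3), (11-3-split), (11-3ns-res), (SC-an) stay open); HC_CM is proved only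
modulo the 7 printed citations (2 remaining named inputs: hLiu418 = stmt-HodgeConjecture-24832, h413 = stmt-HodgeConjecture-24833) until rung 0 closes.

## References
* [Rogawski1990] J. Rogawski, *Automorphic Representations of Unitary Groups in Three Variables*, Ann. of Math. Stud. 123 (1990), §12.1 pp. 171–172, §12.2 p. 173.
* [Casselman1995] W. Casselman, *Introduction to the theory of admissible representations of p-adic reductive groups* (1995), Thm. 5.2.1, Thm. 5.3.1, Cor. 7.1.2.
* [BernsteinZelevinsky1977] I. N. Bernstein, A. V. Zelevinsky, *Induced representations of reductive p-adic groups I*, Ann. Sci. ÉNS 10 (1977), Prop. 1.9 (b), §2.3.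
* [BushnellHenniart2006] C. J. Bushnell, G. Henniart, *The Local Langlands Conjecture for GL(2)* (2006), §2 (constituents along injective maps).
-/

set_option autoImplicit false
-- the mandated namespace repeats `HodgeConjecture.HodgeConjecture`, as in every `Theorems/*.lean` of this sub-problem
set_option linter.dupNamespace false

noncomputable section

open NumberField IsDedekindDomain
open scoped Matrix MatrixGroups

namespace Summit.HodgeConjecture.HodgeConjecture.Cruxes.H413.K2E3LocalIrrepCuspidalOrPrincipalThree

open Literature.NumberTheory.Rogawski1990 Literature.NumberTheory.Automorphic Literature.NumberTheory.Automorphic.UnitaryGroup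
open Summit.HodgeConjecture.HodgeConjecture.Cruxes.H413.F0P3JacquetEmbeddingDichotomy

/-- **LEAF (11-3ns-cls) «CUSPIDAL OR PRINCIPAL» — at a NON-SPLIT `v`, every irreducible smooth class of `U(Φ₃)(L⁺_v)` is supercuspidal or a constituent of a principal
series `i_G(χ)` with `χ` a character of the torus with continuous value** (★ D2′ re-spelled: `χ = cmTorusCharPair L v χ₁ χ₂`, continuous by ★
`continuous_cmTorusCharPair_apply`; the constituent relation from the injective intertwiner by ★ `isConstituentOf_mk_self` + ★ `IsConstituentOf.of_injective`).
[cite: Rogawski1990, §12.1 p. 171; §12.2 p. 172] [cite: Casselman1995, Thm. 5.2.1, Cor. 7.1.2] [cite: BernsteinZelevinsky1977, Prop. 1.9 (b), §2.3] -/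
theorem irrClass_isSupercuspidal_or_isConstituentOf_cmPrincipalSeries_three :
    ∀ (L : Type) [Field L] [NumberField L] [IsCMField L] (v : HeightOneSpectrum (𝓞 ↥(maximalRealSubfield L))),
      (∀ w : PlacesOver L v, IsCMField.complexConj L • w.1 = w.1) →
      ∀ c : IrrClass (Gqs L v), c.IsSupercuspidal ∨
        ∃ χ : ↥(cmBorelTriple L 3 v).M →* ℂˣ, Continuous (fun t => ((χ t : ℂˣ) : ℂ)) ∧ c.IsConstituentOf (cmPrincipalSeries L 3 v χ) := by
  intro L _ _ _ v hns c
  have hD := isSupercuspidal_or_exists_injective_intertwiningMap_cmPrincipalSeries_of_irrClass L v hns c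
  rcases hD with h | ⟨r, hr, χ₁, χ₂, h₁, h₂, f, hf⟩
  · exact Or.inl h
  · refine Or.inr ⟨cmTorusCharPair L v χ₁ χ₂, continuous_cmTorusCharPair_apply L v χ₁ χ₂ h₁ h₂, ?_⟩
    rw [← hr]
    exact (IrrClass.isConstituentOf_mk_self r).of_injective f hf

end Summit.HodgeConjecture.HodgeConjecture.Cruxes.H413.K2E3LocalIrrepCuspidalOrPrincipalThree

end
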